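import Summits.Ventures.PercRepro.ProfilePointedCircuitClassesTwelveQuadC

/-!
# PercRepro — THE TWELVE-POINT STATEMENT `InOutBottomTwelve` WHEN EVERY CO-RANK-2 QUADRUPLE CONTAINS A SERIES PAIR
WITH CO-INDEPENDENT COMPLEMENT, II: THE DEFICIENT DEMANDS AND THE CLEAN UNITS OF A FOUR-NON-COLOOP DEMAND
(p5, gen 43; `proofs/P5-GM1.md` §65(i))

With the weights `pwt60b` of part I (`60 / p(U)` on a disjoint pair, `16` for a `(2,0)`-unit, `4` on a clean pair
of a `(2,0)`-unit with a demand of at most four non-coloops): a demand with three non-coloops (`B = K ⊔ P`, `P` a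
parallel triple) sends `≥ 60` (`sixty_le_sum_pwt60b_of_deficient`); a demand with FOUR non-coloops
(`B = K ⊔ D`, `D` of rank `2` without coloops) sends `≥ 60` as soon as `D` contains a parallel pair `{a, a'}` whose
complement `{c, d}` has rank `2` (`sixty_le_sum_pwt60b_of_card_eq_four`): its four disjoint units `B − a`, `B − a'`,
`B − c`, `B − d` weigh `wt, wt, ≥ 12, ≥ 12` with `wt = 16` (a `(2,0)`-unit, one substitution point) or
`60 / (m + 1)`, `m := #(cw(W, a) ∖ S) ≤ 4`, and the clean units `K + c + d + w` (`w ∈ cw(W, a) ∖ S`,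
`clean_pair_unit_facts`) add `4·m`: `32 + 24 + 4`, `120`, `60 + 24`, `40 + 24 + 8`, `30 + 24 + 12`, `24 + 24 + 16`.
The hypothesis «every four points of rank `2` of the dual contain a parallel triple or a parallel pair with a
rank-`2` complement» excludes exactly the four-point line and the two parallel pairs (the two shapes where §63(d)'s
certificate needs the non-clean pairs).  The four-non-coloop demands' sum, the assembly `60·#𝒟 ≤ Σ pwt60b ≤ 60·#𝒰` and the transfer
**`inCount_five_le_outCount_six_of_twelve_of_quad2`** are part III (ProfilePointedCircuitClassesTwelveQuadE) — `in_5(e) ≤ out_6(e)` on every matroid with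
`12` points and rank `7` in which every `4`-set `D` with `ρ(E ∖ D) = 5` contains a `3`-set `P` with `ρ(E ∖ P) = 5`
or a pair `{a, a'}` with `ρ(E ∖ {a, a'}) = 6` and `ρ(E ∖ (D ∖ {a, a'})) = 7` (every co-rank-2 quadruple contains a
series triple or a series pair with co-independent complement).  The quad regime of TwelveQuadB is the special case.
-/

open scoped Matroid

namespace PercRepro.Cogirth

open Finset ThmH Skew Shadow Profile

variable {α : Type} [DecidableEq α] {M : Matroid α} [M.Finite]

section TwelveQuadD

/-- **THE DEMANDS WITH THREE NON-COLOOPS, SECOND WEIGHTS**: `B = K ⊔ P` sends at least `60` — the three disjoint units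
`B − p` carry the common weight `wt`; when `3·wt < 60` (`wt = 16`: a `(2,0)`-unit; `wt = 15`, `12`: three or four
substitution points) one or two points `w ∈ cw(W) ∖ S` supply three clean units `K + p + w` each, of weight `4`. -/
theorem sixty_le_sum_pwt60b_of_deficient (hn : (gr M).card = 12) (hR : rk M (gr M) = 5)
    (hll : ∀ x ∈ gr M, rk M {x} = 1) {S : Finset α} (hS1 : S.card = 1) {W : Finset α}
    (hW : W ∈ pdem M S) (hd : deficient M W) : 60 ≤ ∑ U ∈ punit M S, pwt60b M S W U := by
  obtain ⟨hWg, hW5, hSW, hWr, hWc⟩ := mem_pdem.1 hW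
  obtain ⟨hc3, hr1⟩ := nonco_card_eq_three_of_deficient hn hll hW hd
  have hBg : gr M \ W ⊆ gr M := sdiff_subset
  have hncB : nonco M W ⊆ gr M \ W := filter_subset _ _
  have hncg : nonco M W ⊆ gr M := hncB.trans hBg
  obtain ⟨p₀, hp₀⟩ : (nonco M W).Nonempty := card_pos.1 (by omega)
  set wt : ℕ := (if (cw M W p₀).card = 1 ∧ cw M W p₀ ∩ S = ∅ then 16 else 60 / ((cw M W p₀ \ S).card + 1))
    with hwt
  have hcw : ∀ p ∈ nonco M W, cw M W p = cw M W p₀ := fun p hp =>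
    cw_eq_of_parallel hll hWg (hncg hp) (hncg hp₀) (rk_pair_le_one_of_mem_nonco hn hll hW hd hp hp₀)
  have hwtp : ∀ p ∈ nonco M W, pwt60b M S W ((gr M \ W).erase p) = wt := by
    intro p hp
    rw [pwt60b_erase_eq hW hp, hcw p hp]
  have hF₁ : (nonco M W).image (fun p => (gr M \ W).erase p) ⊆ punit M S := by
    rw [← filter_punit_inter_eq_image hn hR hW]
    exact filter_subset _ _
  have hinj₁ : Set.InjOn (fun p => (gr M \ W).erase p) (nonco M W) :=
    fun p hp p' hp' h => (gr M \ W).erase_injOn (hncB (mem_coe.1 hp)) (hncB (mem_coe.1 hp')) h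
  have hsum₁ : ∑ U ∈ (nonco M W).image (fun p => (gr M \ W).erase p), pwt60b M S W U = 3 * wt := by
    rw [sum_image hinj₁, sum_congr rfl hwtp, sum_const, hc3, smul_eq_mul]
  rcases Nat.lt_or_ge (3 * wt) 60 with hlt | hge
  · have hm4 := card_cw_sdiff_le_four hW hS1 p₀
    have hk : ∃ k, 1 ≤ k ∧ k ≤ (cw M W p₀ \ S).card ∧ 60 ≤ 3 * wt + 12 * k := by
      rw [hwt] at hlt ⊢
      split_ifs at hlt ⊢ with h20
      · refine ⟨1, le_refl 1, ?_, by norm_num⟩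
        have : cw M W p₀ \ S = cw M W p₀ := by
          rw [Finset.sdiff_eq_self_iff_disjoint, disjoint_iff_inter_eq_empty]
          exact h20.2
        rw [this, h20.1]
      · have hm3 : 3 ≤ (cw M W p₀ \ S).card := by
          by_contra hlt3
          have : (cw M W p₀ \ S).card ≤ 2 := by omega
          interval_cases (cw M W p₀ \ S).card <;> norm_num at hlt
        interval_cases (cw M W p₀ \ S).card
        · exact ⟨2, by norm_num, by norm_num, by norm_num⟩
        · exact ⟨2, by norm_num, by norm_num, by norm_num⟩
    obtain ⟨k, hk1, hkm, hk60⟩ := hk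
    obtain ⟨T, hTsub, hTk⟩ := exists_subset_card_eq (s := cw M W p₀ \ S) (n := k) hkm
    have hcl : ∀ p ∈ nonco M W, ∀ w ∈ T,
        insert w (insert p ((gr M \ W) \ nonco M W)) ∈ punit M S ∧
          pwt60b M S W (insert w (insert p ((gr M \ W) \ nonco M W))) = 4 := by
      intro p hp w hw
      have h := clean_unit_facts hn hR hll hW hd hp (by rw [hcw p hp]; exact hTsub hw)
      exact ⟨h.1, pwt60b_eq_four_of_pwt_eq_one hn h.1 h.2⟩
    have hTW : T ⊆ W := fun w hw => (filter_subset _ _ (mem_sdiff.1 (hTsub hw)).1)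
    let V : α × α → Finset α := fun q => insert q.2 (insert q.1 ((gr M \ W) \ nonco M W))
    have hF₂ : ((nonco M W) ×ˢ T).image V ⊆ punit M S := by
      intro U hU
      obtain ⟨q, hq, rfl⟩ := mem_image.1 hU
      rw [mem_product] at hq
      exact (hcl q.1 hq.1 q.2 hq.2).1
    have hinj₂ : Set.InjOn V (((nonco M W) ×ˢ T : Finset (α × α)) : Set (α × α)) := by
      intro q hq q' hq' h
      rw [mem_coe, mem_product] at hq hq'
      simp only [V] at h
      have hpW : q.1 ∉ W := (mem_sdiff.1 (hncB hq.1)).2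
      have hp'W : q'.1 ∉ W := (mem_sdiff.1 (hncB hq'.1)).2
      have hpK : q.1 ∉ (gr M \ W) \ nonco M W := fun h' => (mem_sdiff.1 h').2 hq.1
      have hwW : q.2 ∈ W := hTW hq.2
      have hw'W : q'.2 ∈ W := hTW hq'.2
      have hwK : q.2 ∉ (gr M \ W) \ nonco M W := fun h' => (mem_sdiff.1 (mem_sdiff.1 h').1).2 hwW
      have h1 : q.2 ∈ insert q'.2 (insert q'.1 ((gr M \ W) \ nonco M W)) := by
        rw [← h]; exact mem_insert_self _ _
      rw [mem_insert, mem_insert] at h1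
      have hw : q.2 = q'.2 := by
        rcases h1 with h1 | h1 | h1
        · exact h1
        · exact absurd (h1 ▸ hwW) hp'W
        · exact absurd h1 hwK
      have h2 : q.1 ∈ insert q'.2 (insert q'.1 ((gr M \ W) \ nonco M W)) := by
        rw [← h]; exact mem_insert_of_mem (mem_insert_self _ _)
      rw [mem_insert, mem_insert] at h2
      have hp : q.1 = q'.1 := by
        rcases h2 with h2 | h2 | h2
        · exact absurd (h2 ▸ hw'W) hpW
        · exact h2
        · exact absurd h2 hpK
      exact Prod.ext hp hw
    have hval : ∀ q ∈ (nonco M W) ×ˢ T, pwt60b M S W (V q) = 4 := by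
      intro q hq
      rw [mem_product] at hq
      exact (hcl q.1 hq.1 q.2 hq.2).2
    have hsum₂ : ∑ U ∈ ((nonco M W) ×ˢ T).image V, pwt60b M S W U = 12 * k := by
      rw [sum_image hinj₂, sum_congr rfl hval, sum_const, card_product, hc3, hTk, smul_eq_mul]
      ring
    have hdisj : Disjoint ((nonco M W).image (fun p => (gr M \ W).erase p)) (((nonco M W) ×ˢ T).image V) := by
      rw [disjoint_left]
      intro U hU₁ hU₂
      obtain ⟨p, _, rfl⟩ := mem_image.1 hU₁
      obtain ⟨q, hq, hq'⟩ := mem_image.1 hU₂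
      rw [mem_product] at hq
      have : q.2 ∈ (gr M \ W).erase p := by rw [← hq']; exact mem_insert_self _ _
      exact (mem_sdiff.1 (erase_subset _ _ this)).2 (hTW hq.2)
    calc 60 ≤ 3 * wt + 12 * k := hk60
      _ = ∑ U ∈ (nonco M W).image (fun p => (gr M \ W).erase p) ∪ ((nonco M W) ×ˢ T).image V,
            pwt60b M S W U := by
          rw [sum_union hdisj, hsum₁, hsum₂]
      _ ≤ ∑ U ∈ punit M S, pwt60b M S W U := sum_le_sum_of_subset (union_subset hF₁ hF₂)
  · calc 60 ≤ 3 * wt := hge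
      _ = ∑ U ∈ (nonco M W).image (fun p => (gr M \ W).erase p), pwt60b M S W U := hsum₁.symm
      _ ≤ ∑ U ∈ punit M S, pwt60b M S W U := sum_le_sum_of_subset hF₁

/-- **THE STRUCTURE OF A DEMAND WITH FOUR NON-COLOOPS**: `B = K ⊔ nonco(W)` with `K` three coloops of `B` (every
point of `K` is a coloop of every subset of `B` containing it), and `ρ(nonco(W)) = 2`; no three points of
`nonco(W)` are pairwise parallel (the fourth would be a coloop). -/
theorem nonco_facts_of_card_eq_four (hn : (gr M).card = 12) {S W : Finset α} (hW : W ∈ pdem M S)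
    (h4 : (nonco M W).card = 4) :
    (∀ b ∈ (gr M \ W) \ nonco M W, rk M ((gr M \ W).erase b) + 1 = rk M (gr M \ W)) ∧
      rk M (nonco M W) = 2 ∧ ((gr M \ W) \ nonco M W).card = 3 ∧
      ¬ ∃ P ⊆ nonco M W, P.card = 3 ∧ rk M P = 1 := by
  obtain ⟨hWg, hW5, _, _, hWc⟩ := mem_pdem.1 hW
  have hBg : gr M \ W ⊆ gr M := sdiff_subset
  have hB7 : (gr M \ W).card = 7 := by rw [card_sdiff_of_subset hWg, hn, hW5]
  have hncB : nonco M W ⊆ gr M \ W := filter_subset _ _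
  have hco : ∀ b ∈ (gr M \ W) \ nonco M W, rk M ((gr M \ W).erase b) + 1 = rk M (gr M \ W) := by
    intro b hb
    rw [mem_sdiff] at hb
    have hnot : ¬ rk M ((gr M \ W).erase b) = 5 :=
      fun h => hb.2 (by unfold nonco; exact mem_filter.2 ⟨hb.1, h⟩)
    have h1 := rk_le_rk_erase_add_one (M := M) hBg hb.1
    have h2 := rk_mono' (M := M) (erase_subset b (gr M \ W))
    omega
  have hK := rk_sdiff_add_card_eq_of_forall_coloop hBg sdiff_subset hco ((gr M \ W) \ nonco M W)
    (Subset.refl _)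
  rw [Finset.sdiff_sdiff_eq_self hncB, card_sdiff_of_subset hncB, hB7, hWc, h4] at hK
  have hKcard : ((gr M \ W) \ nonco M W).card = 3 := by rw [card_sdiff_of_subset hncB, hB7, h4]
  refine ⟨hco, by omega, hKcard, ?_⟩
  rintro ⟨P, hPD, hP3, hP1⟩
  have hx1 : (nonco M W \ P).card = 1 := by rw [card_sdiff_of_subset hPD, h4, hP3]
  obtain ⟨x, hx⟩ := card_eq_one.1 hx1
  have hxmem : x ∈ nonco M W \ P := by rw [hx]; exact mem_singleton_self x
  rw [mem_sdiff] at hxmem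
  have hxn : rk M ((gr M \ W).erase x) = 5 := by unfold nonco at hxmem; exact (mem_filter.1 hxmem.1).2
  have hBx : (gr M \ W).erase x ⊆ ((gr M \ W) \ nonco M W) ∪ P := by
    intro a ha
    rw [mem_erase] at ha
    rw [mem_union, mem_sdiff]
    by_cases haP : a ∈ P
    · exact Or.inr haP
    · left
      refine ⟨ha.2, fun han => ?_⟩
      have : a ∈ nonco M W \ P := mem_sdiff.2 ⟨han, haP⟩
      rw [hx, mem_singleton] at this
      exact ha.1 this
  have hsub := rk_union_add_rk_inter_le (M := M) ((gr M \ W) \ nonco M W) P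
  have hKr := rk_le_card (M := M) ((gr M \ W) \ nonco M W)
  have hmono := rk_mono' (M := M) hBx
  omega

/-- **THE CLEAN UNITS OF A FOUR-NON-COLOOP DEMAND**: for `nonco(W) = {a, a'} ⊔ R` with `a ∥ a'` and `ρ(R) = 2`,
and a substitution point `w ∈ cw(W, a) ∖ S`, the set `V := K ∪ R + w = (B ∖ {a, a'}) + w` is a `(2,0)`-unit
(`E ∖ V = (W − w) + a + a'`, circuit `{a, a'}`), `W ∩ V = {w}`, `B ∖ V = {a, a'}`, hence of second weight `4`. -/
theorem clean_pair_unit_facts (hn : (gr M).card = 12) (hR : rk M (gr M) = 5) (hll : ∀ x ∈ gr M, rk M {x} = 1)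
    {S W : Finset α} (hW : W ∈ pdem M S) (h4 : (nonco M W).card = 4) {a a' : α} (ha : a ∈ nonco M W)
    (ha' : a' ∈ nonco M W) (haa' : a ≠ a') (hpar : rk M {a, a'} ≤ 1)
    (hRr : rk M (nonco M W \ {a, a'}) = 2) {w : α} (hw : w ∈ cw M W a \ S) :
    insert w ((gr M \ W) \ {a, a'}) ∈ punit M S ∧ pwt60b M S W (insert w ((gr M \ W) \ {a, a'})) = 4 := by
  obtain ⟨hWg, hW5, hSW, hWr, hWc⟩ := mem_pdem.1 hW
  obtain ⟨hco, hr2, hK3, -⟩ := nonco_facts_of_card_eq_four hn hW h4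
  have hBg : gr M \ W ⊆ gr M := sdiff_subset
  have hB7 : (gr M \ W).card = 7 := by rw [card_sdiff_of_subset hWg, hn, hW5]
  have hncB : nonco M W ⊆ gr M \ W := filter_subset _ _
  have haB : a ∈ gr M \ W := hncB ha
  have ha'B : a' ∈ gr M \ W := hncB ha'
  have hag : a ∈ gr M := hBg haB
  have ha'g : a' ∈ gr M := hBg ha'B
  have haW : a ∉ W := (mem_sdiff.1 haB).2
  have ha'W : a' ∉ W := (mem_sdiff.1 ha'B).2
  have haS : a ∉ S := fun h => haW (hSW h)
  have ha'S : a' ∉ S := fun h => ha'W (hSW h)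
  have hpairB : ({a, a'} : Finset α) ⊆ gr M \ W := insert_subset haB (singleton_subset_iff.2 ha'B)
  rw [mem_sdiff] at hw
  obtain ⟨hwcw, hwS⟩ := hw
  have hwW : w ∈ W := by unfold cw at hwcw; exact (mem_filter.1 hwcw).1
  have hwr : rk M (insert a (W.erase w)) = 5 := by unfold cw at hwcw; exact (mem_filter.1 hwcw).2
  have hwg : w ∈ gr M := hWg hwW
  have hwB : w ∉ gr M \ W := fun h => (mem_sdiff.1 h).2 hwW
  have hwV' : w ∉ (gr M \ W) \ {a, a'} := fun h => hwB (mem_sdiff.1 h).1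
  -- `B ∖ {a, a'}` has five points and rank `5`: its three coloops and the rank-`2` pair `R`
  have hV5 : ((gr M \ W) \ {a, a'}).card = 5 := by
    rw [card_sdiff_of_subset hpairB, hB7, card_pair haa']
  have hsub' : (gr M \ W) \ {a, a'} ⊆ gr M \ W := sdiff_subset
  -- the coloops of `B` inside `B ∖ {a, a'}` are coloops of it, so its rank is `ρ(R) + 3 = 5`
  have hco' : ∀ b ∈ (gr M \ W) \ nonco M W,
      rk M (((gr M \ W) \ {a, a'}).erase b) + 1 = rk M ((gr M \ W) \ {a, a'}) := by
    intro b hb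
    have hbV : b ∈ (gr M \ W) \ {a, a'} := by
      rw [mem_sdiff] at hb ⊢
      refine ⟨hb.1, fun h => hb.2 ?_⟩
      rw [mem_insert, mem_singleton] at h
      rcases h with rfl | rfl <;> assumption
    exact rk_erase_add_one_of_coloop hBg hsub' hbV (hco b hb)
  have hKsub : (gr M \ W) \ nonco M W ⊆ (gr M \ W) \ {a, a'} := by
    intro x hx
    rw [mem_sdiff] at hx ⊢
    refine ⟨hx.1, fun h => hx.2 ?_⟩
    rw [mem_insert, mem_singleton] at h
    rcases h with rfl | rfl <;> assumption
  have hrkV := rk_sdiff_add_card_eq_of_forall_coloop (hsub'.trans hBg) hKsub hco' ((gr M \ W) \ nonco M W)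
    (Subset.refl _)
  have hVK : ((gr M \ W) \ {a, a'}) \ ((gr M \ W) \ nonco M W) = nonco M W \ {a, a'} := by
    ext x
    simp only [mem_sdiff]
    constructor
    · rintro ⟨⟨hxB, hx⟩, h⟩
      refine ⟨?_, hx⟩
      by_contra hxn
      exact h ⟨hxB, hxn⟩
    · rintro ⟨hxn, hx⟩
      exact ⟨⟨mem_sdiff.1 (hncB hxn), hx⟩, fun h => h.2 hxn⟩
  rw [hVK, hRr, hK3] at hrkV
  -- the complement of `V` is `(W − w) + a + a'`
  have hZ : gr M \ insert w ((gr M \ W) \ {a, a'}) = insert a (insert a' (W.erase w)) := by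
    ext x
    simp only [mem_sdiff, mem_insert, mem_erase, mem_singleton]
    constructor
    · rintro ⟨hxg, h⟩
      by_cases hxa : x = a
      · exact Or.inl hxa
      by_cases hxa' : x = a'
      · exact Or.inr (Or.inl hxa')
      by_cases hxw : x = w
      · exact absurd (Or.inl hxw) h
      by_cases hxW : x ∈ W
      · exact Or.inr (Or.inr ⟨hxw, hxW⟩)
      · exact absurd (Or.inr ⟨⟨hxg, hxW⟩, fun h' => h'.elim hxa hxa'⟩) h
    · rintro (rfl | rfl | ⟨hxw, hxW⟩)
      · exact ⟨hag, fun h => h.elim (fun h1 => haW (by rw [h1]; exact hwW)) (fun h2 => h2.2 (Or.inl rfl))⟩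
      · exact ⟨ha'g, fun h => h.elim (fun h1 => ha'W (by rw [h1]; exact hwW)) (fun h2 => h2.2 (Or.inr rfl))⟩
      · exact ⟨hWg hxW, fun h => h.elim (fun h1 => hxw h1) (fun h2 => h2.1.2 hxW)⟩
  have hZr : rk M (insert a (insert a' (W.erase w))) = 5 := by
    rw [Finset.insert_comm, rk_insert_insert_eq_of_parallel hll hag (by rw [Finset.pair_comm]; exact hpar)]
    exact hwr
  -- membership in `punit`
  have hVpunit : insert w ((gr M \ W) \ {a, a'}) ∈ punit M S := by
    rw [mem_punit]
    refine ⟨insert_subset hwg (hsub'.trans hBg), ?_, ?_, ?_, ?_⟩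
    · rw [card_insert_of_notMem hwV', hV5]
    · -- `V ∩ S = ∅`: `V ∩ W = {w}` and `w ∉ S`
      rw [← disjoint_iff_inter_eq_empty, disjoint_left]
      intro x hx hxS
      rw [mem_insert] at hx
      rcases hx with rfl | hx
      · exact hwS hxS
      · exact (mem_sdiff.1 (mem_sdiff.1 hx).1).2 (hSW hxS)
    · have h1 := rk_mono' (M := M) (subset_insert w ((gr M \ W) \ {a, a'}))
      have h2 := rk_le_rk_gr (M := M) (insert_subset hwg (hsub'.trans hBg))
      omega
    · rw [hZ]; exact hZr
  refine ⟨hVpunit, ?_⟩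
  -- the circuit of `E ∖ V` is `{a, a'}`
  have hcirc : circ5 M (gr M \ insert w ((gr M \ W) \ {a, a'})) = {a, a'} := by
    rw [hZ]
    ext t
    simp only [mem_circ5, mem_insert, mem_singleton, mem_erase]
    constructor
    · rintro ⟨ht, htr⟩
      rcases ht with rfl | rfl | ⟨htw, htW⟩
      · exact Or.inl rfl
      · exact Or.inr rfl
      · exfalso
        -- removing a point of `W − w` leaves rank `≤ 4`
        have hsub2 : (insert a (insert a' (W.erase w))).erase t ⊆ insert a (insert a' ((W.erase w).erase t)) := by
          intro x hx
          rw [mem_erase, mem_insert, mem_insert, mem_erase] at hx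
          rw [mem_insert, mem_insert, mem_erase, mem_erase]
          rcases hx.2 with h | h | h
          · exact Or.inl h
          · exact Or.inr (Or.inl h)
          · exact Or.inr (Or.inr ⟨hx.1, h⟩)
        have h1 := rk_mono' (M := M) hsub2
        have h2 : rk M (insert a (insert a' ((W.erase w).erase t))) ≤ 4 := by
          rw [rk_insert_insert_eq_of_parallel hll ha'g (by exact hpar)]
          have h3 := rk_insert_le (M := M) a' ((W.erase w).erase t)
          have h4 := rk_le_card (M := M) ((W.erase w).erase t)
          have h5 : ((W.erase w).erase t).card = 3 := by
            rw [card_erase_of_mem (mem_erase.2 ⟨htw, htW⟩), card_erase_of_mem hwW, hW5]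
          omega
        omega
    · rintro (rfl | rfl)
      · refine ⟨Or.inl rfl, ?_⟩
        rw [erase_insert (by
          rw [mem_insert, mem_erase]
          rintro (h | ⟨_, h⟩)
          · exact haa' h
          · exact haW h)]
        rw [rk_insert_eq_of_parallel hll ha'g hag (by rw [Finset.pair_comm]; exact hpar)
          ((erase_subset w W).trans hWg)]
        exact hwr
      · refine ⟨Or.inr (Or.inl rfl), ?_⟩
        rw [Finset.insert_comm, erase_insert (by
          rw [mem_insert, mem_erase]
          rintro (h | ⟨_, h⟩)
          · exact haa' h.symm
          · exact ha'W h)]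
        exact hwr
  have hBV : (gr M \ W) \ insert w ((gr M \ W) \ {a, a'}) = {a, a'} := by
    ext x
    simp only [mem_sdiff, mem_insert, mem_singleton]
    constructor
    · rintro ⟨hxB, h⟩
      by_contra hx
      exact h (Or.inr ⟨hxB, hx⟩)
    · rintro (rfl | rfl)
      · exact ⟨⟨hag, haW⟩, fun h => h.elim (fun h1 => haW (by rw [h1]; exact hwW)) (fun h2 => h2.2 (Or.inl rfl))⟩
      · exact ⟨⟨ha'g, ha'W⟩, fun h => h.elim (fun h1 => ha'W (by rw [h1]; exact hwW))
          (fun h2 => h2.2 (Or.inr rfl))⟩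
  have hWV : W ∩ insert w ((gr M \ W) \ {a, a'}) = {w} := by
    ext x
    simp only [mem_inter, mem_insert, mem_sdiff, mem_singleton]
    constructor
    · rintro ⟨hxW, h⟩
      rcases h with h | ⟨⟨_, hxnW⟩, _⟩
      · exact h
      · exact absurd hxW hxnW
    · rintro rfl
      exact ⟨hwW, Or.inl rfl⟩
  have htype : type20 M S (insert w ((gr M \ W) \ {a, a'})) := by
    unfold type20
    rw [hcirc, card_pair haa']
    refine ⟨rfl, ?_⟩
    rw [← disjoint_iff_inter_eq_empty, disjoint_left]
    intro x hx
    rw [mem_insert, mem_singleton] at hx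
    rcases hx with rfl | rfl
    · exact haS
    · exact ha'S
  unfold pwt60b
  rw [if_neg (by rw [hWV]; exact singleton_ne_empty w)]
  rw [if_pos ⟨by rw [hWV, card_singleton], by rw [hBV, hcirc], htype, by unfold deficient4; omega⟩]

end TwelveQuadD

end PercRepro.Cogirth
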